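import Literature.MathematicalPhysics.KineticTheory.EntropyProductionSigmaRep
import HarnessLib

/-!
# Boltzmann's angular averaging trick for the hard-sphere entropy production

Stage 1 (second half) of the entropy–entropy-production programme for `HardSphereEEP`:
Rezakhanlou–Villani, *Entropy Methods for the Boltzmann Equation*, LNM 1916 (2008), Ch. 1 §1.4.2,
Lemma 1 ("Boltzmann's angular integration trick": `D(f) ≥ (K_B |S^{N-1}|/4) D̄(f)`, "a direct
consequence of Jensen's inequality and the joint convexity of `(X - Y) log X/Y`"), for the hard-sphere
kernel of the tree in dimension three:

* `convexOn_sub_mul_log_div`: `X ↦ (X - Y) log (X/Y)` is convex on `(0, ∞)` (`Y > 0`) — only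
  convexity in `X` is needed, `Y = f f_*` being constant on the collision sphere;
* `mul_sub_mul_log_div_average_le`: Jensen for this profile over a finite measure on a compact space
  (Mathlib's `ConvexOn.map_average_le`);
* `collisionSphereAverage f p = ⨍_{S²} f(v'_s) f(v_*'_s) ds` (`G` of the source), positive and
  measurable in `p`;
* `sphereMeasure_mul_profile_average_le` (**Lemma 1, pointwise in `(v, v_*)`**):
  `|S²| Φ(G(p), F(p)) ≤ ∫_{S²} J(σ-collide s p, p) ds`;
* `entropyProductionBar f = ∫∫ |v - v_*| Φ(G, F) dv dv_*` (`D̄` of the source with the hard-sphere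
  weight) and `entropyProductionBar_le` (**Lemma 1**): `(|S²|/16) D̄(f) ≤ D(f)` for continuous positive
  `f` with integrable entropy-production integrand (e.g. Gaussian-dominated `f`,
  `integrable_epIntegrand`).
-/

noncomputable section

open scoped BigOperators ENNReal Topology InnerProductSpace
open MeasureTheory Set Metric Real

namespace Literature.MathematicalPhysics.KineticTheory

open Literature.Analysis.FluidPDE (entropyProduction)

/-! ## Boltzmann's angular averaging trick (Rezakhanlou–Villani 2008, Ch. 1 §1.4.2, Lemma 1) -/

/-- The one-variable entropy-production profile `Φ_Y(X) = (X - Y) log (X/Y)` is convex in `X > 0`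
for every `Y > 0`: `Φ_Y(X) = X log X - (log Y) X - Y log X + Y log Y`, a sum of the convex
`X log X`, a linear function and `-Y log X`. [folklore] -/
theorem convexOn_sub_mul_log_div {Y : ℝ} (hY : 0 < Y) :
    ConvexOn ℝ (Ioi (0 : ℝ)) (fun X => (X - Y) * log (X / Y)) := by
  have h1 : ConvexOn ℝ (Ioi (0 : ℝ)) (fun X => X * log X) :=
    Real.convexOn_mul_log.subset Ioi_subset_Ici_self (convex_Ioi 0)
  have h2 : ConvexOn ℝ (Ioi (0 : ℝ)) (fun X => (-log Y) * X + Y * log Y) := by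
    refine ⟨convex_Ioi 0, fun x _ y _ a b _ _ hab => le_of_eq ?_⟩
    simp only [smul_eq_mul]
    linear_combination (-(Y * log Y)) * hab
  have h3 : ConvexOn ℝ (Ioi (0 : ℝ)) (fun X => Y * (-log X)) := by
    have := (strictConcaveOn_log_Ioi.concaveOn).neg
    exact this.smul hY.le
  refine ((h1.add h2).add h3).congr fun X hX => ?_
  simp only [Pi.add_apply]
  rw [log_div (ne_of_gt hX) hY.ne']
  ring

/-- `Φ_Y` is continuous on `X > 0`. [folklore] -/
theorem continuousOn_sub_mul_log_div (Y : ℝ) :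
    ContinuousOn (fun X : ℝ => (X - Y) * log (X / Y)) (Ioi 0) := by
  rcases eq_or_ne Y 0 with hY | hY
  · subst hY
    simp only [div_zero, Real.log_zero, mul_zero]
    exact continuousOn_const
  · refine (continuousOn_id.sub continuousOn_const).mul ((continuousOn_id.div_const Y).log ?_)
    intro X hX
    exact div_ne_zero (ne_of_gt hX) hY

/-- **Jensen on the collision sphere**: for a finite nonzero measure `μ` on a compact space and a
continuous positive `h`, `μ(univ) · Φ_Y(⨍ h dμ) ≤ ∫ Φ_Y(h) dμ` (`Y > 0`). [folklore] -/
theorem mul_sub_mul_log_div_average_le {α : Type*} [TopologicalSpace α] [CompactSpace α]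
    [MeasurableSpace α] [OpensMeasurableSpace α] [Nonempty α] (μ : Measure α) [IsFiniteMeasure μ]
    [NeZero μ] {h : α → ℝ} (hc : Continuous h) (hpos : ∀ s, 0 < h s) {Y : ℝ} (hY : 0 < Y) :
    μ.real univ * ((⨍ s, h s ∂μ) - Y) * log ((⨍ s, h s ∂μ) / Y) ≤
      ∫ s, (h s - Y) * log (h s / Y) ∂μ := by
  -- range of `h` lies in a compact interval `[m, M] ⊆ (0, ∞)`
  obtain ⟨s₀, -, hs₀⟩ := isCompact_univ.exists_isMinOn univ_nonempty hc.continuousOn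
  obtain ⟨s₁, -, hs₁⟩ := isCompact_univ.exists_isMaxOn univ_nonempty hc.continuousOn
  set m := h s₀ with hm
  set M := h s₁ with hM
  have hmpos : 0 < m := hpos s₀
  have hrange : ∀ s, h s ∈ Icc m M := fun s => ⟨hs₀ (mem_univ s), hs₁ (mem_univ s)⟩
  have hIcc : Icc m M ⊆ Ioi 0 := fun x hx => lt_of_lt_of_le hmpos hx.1
  have hconv : ConvexOn ℝ (Icc m M) (fun X => (X - Y) * log (X / Y)) :=
    (convexOn_sub_mul_log_div hY).subset hIcc (convex_Icc m M)
  have hcont : ContinuousOn (fun X : ℝ => (X - Y) * log (X / Y)) (Icc m M) :=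
    (continuousOn_sub_mul_log_div Y).mono hIcc
  have hhi : Integrable h μ := by
    refine Integrable.mono' (integrable_const (max |m| |M|)) hc.aestronglyMeasurable
      (Filter.Eventually.of_forall fun s => ?_)
    rw [Real.norm_eq_abs]
    exact abs_le_max_abs_abs (hrange s).1 (hrange s).2
  have hgc : Continuous fun s => (h s - Y) * log (h s / Y) :=
    hcont.comp_continuous hc hrange
  have hgi : Integrable ((fun X : ℝ => (X - Y) * log (X / Y)) ∘ h) μ := by
    obtain ⟨C, hC⟩ := (isCompact_univ.image hgc).isBounded.exists_norm_le
    refine Integrable.mono' (integrable_const C) hgc.aestronglyMeasurable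
      (Filter.Eventually.of_forall fun s => hC _ ⟨s, mem_univ s, rfl⟩)
  have hJ := hconv.map_average_le hcont isClosed_Icc (Filter.Eventually.of_forall hrange) hhi hgi
  -- `μ(univ) ⨍ g = ∫ g`
  have havg : μ.real univ * ⨍ s, (h s - Y) * log (h s / Y) ∂μ = ∫ s, (h s - Y) * log (h s / Y) ∂μ := by
    rw [average_eq, smul_eq_mul, ← mul_assoc, mul_inv_cancel₀ measureReal_univ_ne_zero, one_mul]
  rw [← havg, mul_assoc]
  exact mul_le_mul_of_nonneg_left hJ measureReal_nonneg

/-- The **angular average of the gain term**: `G(p) = ⨍_{S²} f(v'_s) f(v_*'_s) ds`, the mean of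
`F = f ⊗ f` over the collision sphere through `p = (v, v_*)` (uniform probability on `σ`); it is a
function of `(v + v_*, |v|² + |v_*|²)` only (Rezakhanlou–Villani 2008, p. 28: `G = ∮ f'f_*' dσ`).
[cite: RezakhanlouVillani2008, Ch. 1 §1.4.2 p. 28] -/
def collisionSphereAverage (f : V3 → ℝ) (p : V3 × V3) : ℝ :=
  ⨍ s : sphere (0 : V3) 1, f (sigmaCollide s p).1 * f (sigmaCollide s p).2 ∂sphereMeasure

/-- **Boltzmann's angular averaging trick (Jensen), pointwise in `(v, v_*)`**: for continuous
positive `f` and every pair `p`,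
`|S²| · Φ(G(p), F(p)) ≤ ∫_{S²} J(σ-collide s p, p) ds`, `Φ(X, Y) = (X - Y) log (X/Y)`, `F = f f_*`,
`G` the collision-sphere average — convexity of `Φ(·, Y)` (Rezakhanlou–Villani 2008, Ch. 1 §1.4.2,
Lemma 1: "a direct consequence of Jensen's inequality"). [cite: RezakhanlouVillani2008, Ch. 1 §1.4.2 Lemma 1 p. 28] -/
theorem sphereMeasure_mul_profile_average_le {f : V3 → ℝ} (hf : Continuous f) (hpos : ∀ v, 0 < f v)
    (p : V3 × V3) :
    (sphereMeasure (E := V3)).real univ *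
        ((collisionSphereAverage f p - f p.1 * f p.2) *
          log (collisionSphereAverage f p / (f p.1 * f p.2))) ≤
      ∫ s : sphere (0 : V3) 1, epPair f (sigmaCollide s p) p ∂sphereMeasure := by
  haveI : IsFiniteMeasure (sphereMeasure (E := V3)) := by unfold sphereMeasure; infer_instance
  haveI : NeZero (sphereMeasure (E := V3)) := ⟨by unfold sphereMeasure; exact Measure.toSphere_ne_zero _⟩
  haveI : Nonempty (sphere (0 : V3) 1) := (NormedSpace.sphere_nonempty.2 zero_le_one).to_subtype
  have hc : Continuous fun s : sphere (0 : V3) 1 => f (sigmaCollide s p).1 * f (sigmaCollide s p).2 := by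
    have hsc : Continuous fun s : sphere (0 : V3) 1 => sigmaCollide (s : V3) p :=
      continuous_sigmaCollide.comp (continuous_subtype_val.prodMk continuous_const)
    exact (hf.comp (continuous_fst.comp hsc)).mul (hf.comp (continuous_snd.comp hsc))
  have h := mul_sub_mul_log_div_average_le (sphereMeasure (E := V3)) hc
    (fun s => mul_pos (hpos _) (hpos _)) (mul_pos (hpos p.1) (hpos p.2))
  unfold collisionSphereAverage epPair
  rw [mul_assoc] at h
  exact h


/-! ## Lemma 1, integrated form -/

/-- A continuous real function on a compact space is integrable for every finite measure. [folklore] -/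
theorem integrable_of_continuous_compactSpace {α : Type*} [TopologicalSpace α] [CompactSpace α]
    [MeasurableSpace α] [OpensMeasurableSpace α] (μ : Measure α) [IsFiniteMeasure μ] {h : α → ℝ}
    (hc : Continuous h) : Integrable h μ := by
  rcases isEmpty_or_nonempty α with hα | hα
  · exact Integrable.of_finite
  obtain ⟨C, hC⟩ := (isCompact_univ.image hc).isBounded.exists_norm_le
  exact Integrable.mono' (integrable_const C) hc.aestronglyMeasurable
    (Filter.Eventually.of_forall fun s => hC _ ⟨s, mem_univ s, rfl⟩)

/-- The collision-sphere average of a continuous positive `f ⊗ f` is positive. [folklore] -/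
theorem collisionSphereAverage_pos {f : V3 → ℝ} (hf : Continuous f) (hpos : ∀ v, 0 < f v)
    (p : V3 × V3) : 0 < collisionSphereAverage f p := by
  haveI : IsFiniteMeasure (sphereMeasure (E := V3)) := by unfold sphereMeasure; infer_instance
  haveI : NeZero (sphereMeasure (E := V3)) := ⟨by unfold sphereMeasure; exact Measure.toSphere_ne_zero _⟩
  haveI : Nonempty (sphere (0 : V3) 1) := (NormedSpace.sphere_nonempty.2 zero_le_one).to_subtype
  have hsc : Continuous fun s : sphere (0 : V3) 1 => sigmaCollide (s : V3) p :=
    continuous_sigmaCollide.comp (continuous_subtype_val.prodMk continuous_const)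
  have hc : Continuous fun s : sphere (0 : V3) 1 => f (sigmaCollide s p).1 * f (sigmaCollide s p).2 :=
    (hf.comp (continuous_fst.comp hsc)).mul (hf.comp (continuous_snd.comp hsc))
  obtain ⟨s₀, -, hs₀⟩ := isCompact_univ.exists_isMinOn univ_nonempty hc.continuousOn
  have hm : 0 < f (sigmaCollide s₀ p).1 * f (sigmaCollide s₀ p).2 := mul_pos (hpos _) (hpos _)
  unfold collisionSphereAverage
  rw [average_eq, smul_eq_mul]
  refine mul_pos (inv_pos.2 measureReal_univ_pos) (lt_of_lt_of_le ?_ (integral_mono (integrable_const _)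
    (integrable_of_continuous_compactSpace _ hc) fun s => hs₀ (mem_univ s)))
  rw [integral_const, smul_eq_mul]
  exact mul_pos measureReal_univ_pos hm

/-- The collision-sphere average is a measurable function of the pair `(v, v_*)` (a parametric
integral of a jointly continuous integrand). [folklore] -/
theorem measurable_collisionSphereAverage {f : V3 → ℝ} (hf : Continuous f) :
    Measurable (collisionSphereAverage f) := by
  haveI : IsFiniteMeasure (sphereMeasure (E := V3)) := by unfold sphereMeasure; infer_instance
  have hH : Continuous fun x : (V3 × V3) × sphere (0 : V3) 1 =>
      f (sigmaCollide (x.2 : V3) x.1).1 * f (sigmaCollide (x.2 : V3) x.1).2 := by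
    have hsc : Continuous fun x : (V3 × V3) × sphere (0 : V3) 1 => sigmaCollide (x.2 : V3) x.1 :=
      continuous_sigmaCollide.comp ((continuous_subtype_val.comp continuous_snd).prodMk continuous_fst)
    exact (hf.comp (continuous_fst.comp hsc)).mul (hf.comp (continuous_snd.comp hsc))
  have h := (hH.stronglyMeasurable.integral_prod_right' (ν := sphereMeasure (E := V3))).measurable
  unfold collisionSphereAverage
  simp_rw [average_eq]
  exact h.const_smul ((sphereMeasure (E := V3)).real univ)⁻¹

/-- The integrand of `entropyProduction` has extended integral equal to the `σ`-representation
integral. [folklore] -/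
theorem lintegral_ofReal_epIntegrand {f : V3 → ℝ} (hf : Measurable f) :
    ∫⁻ q, ENNReal.ofReal (epIntegrand f q) ∂(((volume : Measure V3).prod volume).prod sphereMeasure) =
      ∫⁻ p : V3 × V3, ENNReal.ofReal ‖p.1 - p.2‖ *
          (4⁻¹ * ∫⁻ s : sphere (0 : V3) 1, ENNReal.ofReal (epPair f (sigmaCollide s p) p)
            ∂sphereMeasure) ∂((volume : Measure V3).prod volume) := by
  have hJm : Measurable (Function.uncurry fun p' p : V3 × V3 => ENNReal.ofReal (epPair f p' p)) := by
    unfold epPair Function.uncurry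
    apply Measurable.ennreal_ofReal
    have h1 : Measurable fun x : (V3 × V3) × (V3 × V3) => f x.1.1 := hf.comp (by fun_prop)
    have h2 : Measurable fun x : (V3 × V3) × (V3 × V3) => f x.1.2 := hf.comp (by fun_prop)
    have h3 : Measurable fun x : (V3 × V3) × (V3 × V3) => f x.2.1 := hf.comp (by fun_prop)
    have h4 : Measurable fun x : (V3 × V3) × (V3 × V3) => f x.2.2 := hf.comp (by fun_prop)
    exact ((h1.mul h2).sub (h3.mul h4)).mul (((h1.mul h2).div (h3.mul h4)).log)
  rw [← lintegral_hardSphereKernel_mul_comp_collide _ hJm]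
  refine lintegral_congr fun q => ?_
  rw [epIntegrand_eq, ENNReal.ofReal_mul]
  unfold hardSphereKernel
  exact le_max_right _ _

/-- **Villani's averaged entropy-production functional for hard spheres**,
`D̄(f) = ∫∫ |v - v_*| Φ(G(v,v_*), F(v,v_*)) dv dv_*` with `F = f f_*`, `G` the collision-sphere average
of `f'f_*'` and `Φ(X, Y) = (X - Y) log (X/Y)` (Rezakhanlou–Villani 2008, Ch. 1 §1.4.2, Lemma 1: the
functional `D̄` there carries the kernel `(1 + |v - v_*|)^{-β}`; here the hard-sphere kernel `|v - v_*|`).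
Bochner integral (junk `0` if not integrable). [cite: RezakhanlouVillani2008, Ch. 1 §1.4.2 Lemma 1 p. 28] -/
def entropyProductionBar (f : V3 → ℝ) : ℝ :=
  ∫ p : V3 × V3, ‖p.1 - p.2‖ *
      ((collisionSphereAverage f p - f p.1 * f p.2) *
        log (collisionSphereAverage f p / (f p.1 * f p.2))) ∂((volume : Measure V3).prod volume)

/-- **Boltzmann's angular averaging trick (Rezakhanlou–Villani 2008, Ch. 1 §1.4.2, Lemma 1), hard
spheres**: for continuous positive `f` whose entropy-production integrand is integrable,
`(|S²|/16) · D̄(f) ≤ D(f)`: the entropy production dominates the averaged functional in which the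
gain term `f'f_*'` is replaced by its mean `G` over the collision sphere (Jensen for the convex
`X ↦ (X - F) log (X/F)`; `|S²| = σ(S²)`, `σ = volume.toSphere`; the constant `1/16 = ¼ · ¼` collects
the `¼` of `D` and the hard-sphere `σ`-kernel `|z|/4`). [cite: RezakhanlouVillani2008, Ch. 1 §1.4.2 Lemma 1 p. 28] -/
theorem entropyProductionBar_le {f : V3 → ℝ} (hf : Continuous f) (hpos : ∀ v, 0 < f v)
    (hint : Integrable (epIntegrand f) (((volume : Measure V3).prod volume).prod sphereMeasure)) :
    (sphereMeasure (E := V3)).real univ / 16 * entropyProductionBar f ≤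
      entropyProduction hardSphereKernel f := by
  haveI : IsFiniteMeasure (sphereMeasure (E := V3)) := by unfold sphereMeasure; infer_instance
  set μ2 : Measure (V3 × V3) := (volume : Measure V3).prod volume with hμ2
  set S : ℝ := (sphereMeasure (E := V3)).real univ with hS
  have hS0 : 0 ≤ S := measureReal_nonneg
  -- the two sides as extended integrals
  set L : ℝ≥0∞ := ∫⁻ p : V3 × V3, ENNReal.ofReal ‖p.1 - p.2‖ *
      (4⁻¹ * ∫⁻ s : sphere (0 : V3) 1, ENNReal.ofReal (epPair f (sigmaCollide s p) p)
        ∂sphereMeasure) ∂μ2 with hL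
  set g : V3 × V3 → ℝ := fun p => ‖p.1 - p.2‖ *
      ((collisionSphereAverage f p - f p.1 * f p.2) *
        log (collisionSphereAverage f p / (f p.1 * f p.2))) with hg
  have hD : entropyProduction hardSphereKernel f = 4⁻¹ * L.toReal :=
    entropyProduction_hardSphere_sigmaRep hf.measurable hpos
  have hLtop : L ≠ ⊤ := by
    rw [hL, ← lintegral_ofReal_epIntegrand hf.measurable,
      ← ofReal_integral_eq_lintegral_ofReal hint (Filter.Eventually.of_forall fun q => ?_)]
    · exact ENNReal.ofReal_ne_top
    · rw [Pi.zero_apply, epIntegrand_eq]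
      exact mul_nonneg (by unfold hardSphereKernel; exact le_max_right _ _) (epPair_nonneg hpos _ _)
  -- pointwise: Jensen
  have hgnn : ∀ p, 0 ≤ g p := fun p => by
    have hG := collisionSphereAverage_pos hf hpos p
    have hF : 0 < f p.1 * f p.2 := mul_pos (hpos _) (hpos _)
    refine mul_nonneg (norm_nonneg _) ?_
    rcases le_total (f p.1 * f p.2) (collisionSphereAverage f p) with h | h
    · exact mul_nonneg (sub_nonneg.2 h) (Real.log_nonneg ((one_le_div hF).2 h))
    · exact mul_nonneg_of_nonpos_of_nonpos (sub_nonpos.2 h)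
        (Real.log_nonpos (div_pos hG hF).le ((div_le_one hF).2 h))
  have hpt : ∀ p, ENNReal.ofReal (4⁻¹ * S * g p) ≤ ENNReal.ofReal ‖p.1 - p.2‖ *
      (4⁻¹ * ∫⁻ s : sphere (0 : V3) 1, ENNReal.ofReal (epPair f (sigmaCollide s p) p) ∂sphereMeasure) := by
    intro p
    have hJ := sphereMeasure_mul_profile_average_le hf hpos p
    have hsc : Continuous fun s : sphere (0 : V3) 1 => sigmaCollide (s : V3) p :=
      continuous_sigmaCollide.comp (continuous_subtype_val.prodMk continuous_const)
    have hJc : Continuous fun s : sphere (0 : V3) 1 => epPair f (sigmaCollide s p) p := by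
      unfold epPair
      have h1 : Continuous fun s : sphere (0 : V3) 1 => f (sigmaCollide s p).1 :=
        hf.comp (continuous_fst.comp hsc)
      have h2 : Continuous fun s : sphere (0 : V3) 1 => f (sigmaCollide s p).2 :=
        hf.comp (continuous_snd.comp hsc)
      refine ((h1.mul h2).sub continuous_const).mul (((h1.mul h2).div_const _).log fun s => ?_)
      exact div_ne_zero (mul_pos (hpos _) (hpos _)).ne' (mul_pos (hpos _) (hpos _)).ne'
    have hJi : Integrable (fun s : sphere (0 : V3) 1 => epPair f (sigmaCollide s p) p) sphereMeasure :=
      integrable_of_continuous_compactSpace _ hJc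
    rw [← ofReal_integral_eq_lintegral_ofReal hJi (Filter.Eventually.of_forall fun s =>
        epPair_nonneg hpos _ _),
      show 4⁻¹ * S * g p = ‖p.1 - p.2‖ * (4⁻¹ * (S * ((collisionSphereAverage f p - f p.1 * f p.2) *
        log (collisionSphereAverage f p / (f p.1 * f p.2))))) by rw [hg]; ring,
      ENNReal.ofReal_mul (norm_nonneg _), ENNReal.ofReal_mul (by norm_num),
      ENNReal.ofReal_inv_of_pos four_pos, ENNReal.ofReal_ofNat]
    gcongr
  have hRL : ∫⁻ p, ENNReal.ofReal (4⁻¹ * S * g p) ∂μ2 ≤ L := lintegral_mono hpt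
  -- `g` is integrable
  have hgm : Measurable g := by
    have hG := measurable_collisionSphereAverage hf
    have hF : Measurable fun p : V3 × V3 => f p.1 * f p.2 := by fun_prop
    exact (continuous_norm.measurable.comp (measurable_fst.sub measurable_snd)).mul
      ((hG.sub hF).mul ((hG.div hF).log))
  have hgi : Integrable (fun p => 4⁻¹ * S * g p) μ2 := by
    refine ⟨(hgm.const_mul _).aestronglyMeasurable, ?_⟩
    rw [hasFiniteIntegral_iff_ofReal (Filter.Eventually.of_forall fun p =>
      mul_nonneg (by positivity) (hgnn p))]
    exact lt_of_le_of_lt hRL (lt_top_iff_ne_top.2 hLtop)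
  have hR : ∫ p, 4⁻¹ * S * g p ∂μ2 = (∫⁻ p, ENNReal.ofReal (4⁻¹ * S * g p) ∂μ2).toReal :=
    integral_eq_lintegral_of_nonneg_ae (Filter.Eventually.of_forall fun p =>
      mul_nonneg (by positivity) (hgnn p)) hgi.aestronglyMeasurable
  -- assemble
  have hbar : S / 16 * entropyProductionBar f = 4⁻¹ * ∫ p, 4⁻¹ * S * g p ∂μ2 := by
    rw [integral_const_mul]
    unfold entropyProductionBar
    rw [hμ2, hg]
    ring
  rw [hbar, hD, hR]
  exact mul_le_mul_of_nonneg_left (ENNReal.toReal_mono hLtop hRL) (by norm_num)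

end Literature.MathematicalPhysics.KineticTheory

end
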